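import Mathlib
import Summits.CriticalPhenomena.CardyFormulaZ2.Theorems.CardySelfRefinementGradientComparabilityStubLevelSetTransport
import HarnessLib

/-!
# Crux `GradientComparability` (stmt-CriticalPhenomena-10269), line `monotone-product-coordinates`:
# bulk level-set transport from the INTEGRATED bet

Route `CardySelfRefinement`, sub-problem `CriticalPhenomena/CardyFormulaZ2`; vocabulary
(`P`, `Dρ`, `Dc`, `PathOK`, …) from `CardySelfRefinementDefs` (definitionally the route's
`let`-chain).  Helper of stub `stub_bet` (THE BET, the line's open conjecture).

The landed `levelSetTransport_bulk` (`…StubLevelSetTransport`) derives the bulk clause of the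
level-set comparability (same-level band points of `[0, 1-δ] × [0,1]` have comparable `Dc`,
mesh-uniformly) from the POINTWISE bet (`Dρ/Dc` is `Θ`-Lipschitz in `c` across the level band).
The transport only integrates the identity

  `d/dρ log Dc(ρ, ℓ ρ) = ∂_c(Dρ/Dc)(ρ, ℓ ρ)`                                              (★)

along the level leaf `c = ℓ(ρ)` (`ℓ' = -Dρ/Dc`, `Dc > 0`), so the INTEGRATED bet ∫BET — a
mesh-uniform bound `Θ` on `|∫_{ρ₀}^{ρ₁} ∂_c(Dρ/Dc)(ρ, ℓ ρ) dρ|` along every level leaf of the band,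
the statement `stub_intBet` of the sibling line `level-curve-log-slope-identity` — already gives the
same conclusion with constant `exp Θ` (`levelSetTransport_bulk_of_intBet`, this file).  ∫BET is
implied by the pointwise bet (`|∂_c(Dρ/Dc)| ≤ Θ ⟹ |∫| ≤ Θ |ρ₁ - ρ₀| ≤ Θ`) and is strictly weaker
(it tolerates integrable blow-ups and oscillation of `∂_c(Dρ/Dc)`).

Calculus (pure analysis of a `C²` function `Φ : ℝ² → ℝ`; `Φ_ρ q = fderiv ℝ Φ q (1,0)`,
`Φ_c q = fderiv ℝ Φ q (0,1)`; the integrand is written `deriv (fun y => Φ_ρ (ρ,y) / Φ_c (ρ,y)) (ℓ ρ)`,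
whose closed form is `hasDerivAt_levelSlope`):
* `hasDerivWithinAt_log_fderiv_snd_leaf` — (★) in derivative form (chain rule + Schwarz);
* `continuousOn_deriv_levelSlope_leaf` — the integrand is continuous along a continuous leaf;
* `integral_deriv_levelSlope_leaf` — (★) integrated between any two leaf parameters (FTC).
Main theorem: the leaf through two same-level band points (`stub_levelCurve_IFT`, positivity of `Dc`
on the band from `levelCurves_unconditional`, boundary values `stub_boundaryValues`), the
identification of the line's integrand `derivWithin (c ↦ Dρ/Dc) [0,1] (ℓ ρ)` with the integrand above
(`P = Φ` on the square, `exists_contDiff_two_eq_P`), ∫BET along the leaf, and `exp ∘ log`.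
Port of the sibling skeleton's `sliceTransport_of_intBet`
(`Cruxes/GradientComparability/Lines/level_curve_log_slope_identity.lean`), def-free.
-/

noncomputable section

namespace Summit.CriticalPhenomena.CardyFormulaZ2.Theorems.CardySelfRefinement

open scoped Topology
open Filter Set MeasureTheory
open Literature.Probability.LatticeModels Literature.Probability.Percolation
open Literature.Probability.Percolation.QuadCrossing
open Summit.CriticalPhenomena.CardyFormulaZ2.Theses.CardySelfRefinement

/-! ## Calculus of a `C²` function along a level leaf -/

/-- Second partials of a `C²` function are continuous: `q ↦ Φ''(q) u w` for fixed directions. -/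
theorem continuous_sndFDeriv_apply {Φ : ℝ × ℝ → ℝ} (hΦ : ContDiff ℝ 2 Φ) (u w : ℝ × ℝ) :
    Continuous fun q => fderiv ℝ (fderiv ℝ Φ) q u w := by
  have h : Continuous fun q => fderiv ℝ (fderiv ℝ Φ) q :=
    (hΦ.fderiv_right (m := 1) (by norm_num)).continuous_fderiv (by norm_num)
  exact (h.clm_apply continuous_const).clm_apply continuous_const

-- adapted from `hasDerivWithinAt_log_dc_leaf` (Cruxes/…/Lines/level_curve_log_slope_identity.lean)
/-- **The level-curve log-slope identity (★), derivative form.**  If `ℓ` has derivative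
`-Φ_ρ/Φ_c` at `ρ` within `s` (the level ODE) and `Φ_c (ρ, ℓ ρ) > 0`, then
`x ↦ log Φ_c (x, ℓ x)` has derivative `∂_c(Φ_ρ/Φ_c)(ρ, ℓ ρ)` within `s` at `ρ` (chain rule and the
symmetry of the second derivative). -/
theorem hasDerivWithinAt_log_fderiv_snd_leaf {Φ : ℝ × ℝ → ℝ} (hΦ : ContDiff ℝ 2 Φ) {ℓ : ℝ → ℝ}
    {s : Set ℝ} {ρ : ℝ}
    (hℓ : HasDerivWithinAt ℓ
      (-(fderiv ℝ Φ (ρ, ℓ ρ) (1, 0) / fderiv ℝ Φ (ρ, ℓ ρ) (0, 1))) s ρ)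
    (hpos : 0 < fderiv ℝ Φ (ρ, ℓ ρ) (0, 1)) :
    HasDerivWithinAt (fun x => Real.log (fderiv ℝ Φ (x, ℓ x) (0, 1)))
      (deriv (fun y => fderiv ℝ Φ (ρ, y) (1, 0) / fderiv ℝ Φ (ρ, y) (0, 1)) (ℓ ρ)) s ρ := by
  rw [(hasDerivAt_levelSlope hΦ ρ (ℓ ρ) hpos.ne').deriv]
  have hγ : HasDerivWithinAt (fun y => ((y, ℓ y) : ℝ × ℝ))
      ((1 : ℝ), -(fderiv ℝ Φ (ρ, ℓ ρ) (1, 0) / fderiv ℝ Φ (ρ, ℓ ρ) (0, 1))) s ρ :=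
    (hasDerivWithinAt_id ρ _).prodMk hℓ
  have h := (hasDerivWithinAt_fderiv_along hΦ hγ (0, 1)).log hpos.ne'
  refine h.congr_deriv ?_
  rw [clm₂_apply_prod, sndFDeriv_symm hΦ (ρ, ℓ ρ) (1, 0) (0, 1)]
  have hne : fderiv ℝ Φ (ρ, ℓ ρ) (0, 1) ≠ 0 := hpos.ne'
  field_simp
  ring

/-- The integrand `∂_c(Φ_ρ/Φ_c)(ρ, ℓ ρ)` is continuous along a continuous leaf on which `Φ_c ≠ 0`
(its closed form `hasDerivAt_levelSlope` is a rational expression in first and second partials). -/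
theorem continuousOn_deriv_levelSlope_leaf {Φ : ℝ × ℝ → ℝ} (hΦ : ContDiff ℝ 2 Φ) {ℓ : ℝ → ℝ}
    {s : Set ℝ} (hℓc : ContinuousOn ℓ s) (hne : ∀ ρ ∈ s, fderiv ℝ Φ (ρ, ℓ ρ) (0, 1) ≠ 0) :
    ContinuousOn
      (fun ρ => deriv (fun y => fderiv ℝ Φ (ρ, y) (1, 0) / fderiv ℝ Φ (ρ, y) (0, 1)) (ℓ ρ)) s := by
  have heq : Set.EqOn
      (fun ρ => deriv (fun y => fderiv ℝ Φ (ρ, y) (1, 0) / fderiv ℝ Φ (ρ, y) (0, 1)) (ℓ ρ))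
      (fun ρ => (fderiv ℝ (fderiv ℝ Φ) (ρ, ℓ ρ) (0, 1) (1, 0) * fderiv ℝ Φ (ρ, ℓ ρ) (0, 1) -
          fderiv ℝ Φ (ρ, ℓ ρ) (1, 0) * fderiv ℝ (fderiv ℝ Φ) (ρ, ℓ ρ) (0, 1) (0, 1)) /
          fderiv ℝ Φ (ρ, ℓ ρ) (0, 1) ^ 2) s :=
    fun ρ hρ => (hasDerivAt_levelSlope hΦ ρ (ℓ ρ) (hne ρ hρ)).deriv
  refine ContinuousOn.congr ?_ heq
  have hcurve : ContinuousOn (fun ρ => ((ρ, ℓ ρ) : ℝ × ℝ)) s := continuousOn_id.prodMk hℓc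
  have hH : ∀ u w : ℝ × ℝ, ContinuousOn (fun ρ => fderiv ℝ (fderiv ℝ Φ) (ρ, ℓ ρ) u w) s :=
    fun u w => (continuous_sndFDeriv_apply hΦ u w).comp_continuousOn hcurve
  have hD : ∀ w : ℝ × ℝ, ContinuousOn (fun ρ => fderiv ℝ Φ (ρ, ℓ ρ) w) s := fun w =>
    ((hΦ.continuous_fderiv (by norm_num)).clm_apply continuous_const).comp_continuousOn hcurve
  exact (((hH (0, 1) (1, 0)).mul (hD (0, 1))).sub ((hD (1, 0)).mul (hH (0, 1) (0, 1)))).div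
    ((hD (0, 1)).pow 2) fun ρ hρ => pow_ne_zero 2 (hne ρ hρ)

-- adapted from `integral_slopeDeriv_eq_log_sub` (Cruxes/…/Lines/level_curve_log_slope_identity.lean)
/-- **(★) integrated — the fundamental theorem of calculus along a leaf.**  If `ℓ` solves the
level ODE within `[a,b]` and `Φ_c > 0` along the leaf, then for any two parameters
`ρ₀, ρ₁ ∈ [a,b]` (in either order)
`∫_{ρ₀}^{ρ₁} ∂_c(Φ_ρ/Φ_c)(ρ, ℓ ρ) dρ = log Φ_c (ρ₁, ℓ ρ₁) - log Φ_c (ρ₀, ℓ ρ₀)`. -/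
theorem integral_deriv_levelSlope_leaf {Φ : ℝ × ℝ → ℝ} (hΦ : ContDiff ℝ 2 Φ) {a b : ℝ}
    {ℓ : ℝ → ℝ}
    (hℓ : ∀ ρ ∈ Set.Icc a b, HasDerivWithinAt ℓ
      (-(fderiv ℝ Φ (ρ, ℓ ρ) (1, 0) / fderiv ℝ Φ (ρ, ℓ ρ) (0, 1))) (Set.Icc a b) ρ)
    (hpos : ∀ ρ ∈ Set.Icc a b, 0 < fderiv ℝ Φ (ρ, ℓ ρ) (0, 1))
    {ρ₀ ρ₁ : ℝ} (hρ₀ : ρ₀ ∈ Set.Icc a b) (hρ₁ : ρ₁ ∈ Set.Icc a b) :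
    ∫ ρ in ρ₀..ρ₁, deriv (fun y => fderiv ℝ Φ (ρ, y) (1, 0) / fderiv ℝ Φ (ρ, y) (0, 1)) (ℓ ρ) =
      Real.log (fderiv ℝ Φ (ρ₁, ℓ ρ₁) (0, 1)) - Real.log (fderiv ℝ Φ (ρ₀, ℓ ρ₀) (0, 1)) := by
  have hsub : Set.uIcc ρ₀ ρ₁ ⊆ Set.Icc a b := Set.uIcc_subset_Icc hρ₀ hρ₁
  have hD : ∀ ρ ∈ Set.Icc a b, HasDerivWithinAt (fun x => Real.log (fderiv ℝ Φ (x, ℓ x) (0, 1)))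
      (deriv (fun y => fderiv ℝ Φ (ρ, y) (1, 0) / fderiv ℝ Φ (ρ, y) (0, 1)) (ℓ ρ))
      (Set.Icc a b) ρ :=
    fun ρ hρ => hasDerivWithinAt_log_fderiv_snd_leaf hΦ (hℓ ρ hρ) (hpos ρ hρ)
  refine intervalIntegral.integral_eq_sub_of_hasDeriv_right
    (f := fun x => Real.log (fderiv ℝ Φ (x, ℓ x) (0, 1)))
    (f' := fun ρ => deriv (fun y => fderiv ℝ Φ (ρ, y) (1, 0) / fderiv ℝ Φ (ρ, y) (0, 1)) (ℓ ρ))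
    ?_ ?_ ?_
  · exact fun ρ hρ => (hD ρ (hsub hρ)).continuousWithinAt.mono hsub
  · intro x hx
    have hax : a < x := lt_of_le_of_lt (le_min hρ₀.1 hρ₁.1) hx.1
    have hxb : x < b := lt_of_lt_of_le hx.2 (max_le hρ₀.2 hρ₁.2)
    exact ((hD x ⟨hax.le, hxb.le⟩).hasDerivAt (Icc_mem_nhds hax hxb)).hasDerivWithinAt
  · refine ContinuousOn.intervalIntegrable ?_
    refine (continuousOn_deriv_levelSlope_leaf hΦ ?_ fun ρ hρ => (hpos ρ hρ).ne').mono hsub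
    exact fun ρ hρ => (hℓ ρ hρ).continuousWithinAt

/-! ## The bulk transport from the integrated bet -/

/-- **Bulk level-set transport from the INTEGRATED bet** (helper of stub `stub_bet`, line
`monotone-product-coordinates`; port of the sibling line's `sliceTransport_of_intBet`).  ∫BET — for
`k ∈ {2,3}`, a nonempty quad family, a depth `δ ∈ (0,½]` and levels `0 < vlo < vhi < 1`, a
MESH-UNIFORM bound `Θ` on `|∫_{ρ₀}^{ρ₁} ∂_c(Dρ/Dc)(ρ, ℓ ρ) dρ|` along every level-`v` selection `ℓ`
over `[0, 1-δ]` solving the level ODE, `v ∈ [vlo, vhi]` — implies the bulk clause of the level-set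
comparability: same-level band points of `[0, 1-δ] × [0,1]` have comparable `Dc`, mesh-uniformly
(constant `exp Θ`).  Proof: both points lie on the level leaf `ℓ` of the polynomial `Φ = P`
(`stub_levelCurve_IFT`; uniqueness since `Dc > 0` on the band, `levelCurves_unconditional`;
boundary values `stub_boundaryValues`); along it `log Dc(ρ₁, ℓ ρ₁) - log Dc(ρ₀, ℓ ρ₀)` is the
∫BET integral (`integral_deriv_levelSlope_leaf`, identity (★)). -/
theorem levelSetTransport_bulk_of_intBet :
    (∀ k : ℕ, k = 2 ∨ k = 3 → ∀ (m : ℕ) (F : Fin m → Quad (Set.univ : Set ℂ)), 0 < m →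
      ∀ δ : ℝ, 0 < δ → δ ≤ 1 / 2 → ∀ vlo vhi : ℝ, 0 < vlo → vlo < vhi → vhi < 1 →
        ∃ Θ η₁ : ℝ, 0 ≤ Θ ∧ 0 < η₁ ∧ ∀ η ∈ Set.Ioo 0 η₁,
          ∀ v ∈ Set.Icc vlo vhi, ∀ ℓ : ℝ → ℝ,
            (∀ ρ ∈ Set.Icc (0 : ℝ) (1 - δ), ℓ ρ ∈ Set.Icc (0 : ℝ) 1 ∧ P k m F η ρ (ℓ ρ) = v) →
            (∀ ρ ∈ Set.Icc (0 : ℝ) (1 - δ), HasDerivWithinAt ℓ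
                (-(Dρ k m F η (ρ, ℓ ρ) / Dc k m F η (ρ, ℓ ρ))) (Set.Icc 0 (1 - δ)) ρ) →
            ∀ ρ₀ ∈ Set.Icc (0 : ℝ) (1 - δ), ∀ ρ₁ ∈ Set.Icc (0 : ℝ) (1 - δ),
              |∫ ρ in ρ₀..ρ₁, derivWithin (fun c => Dρ k m F η (ρ, c) / Dc k m F η (ρ, c))
                  (Set.Icc 0 1) (ℓ ρ)| ≤ Θ) →
    ∀ k : ℕ, k = 2 ∨ k = 3 → ∀ γ : unitInterval → ℝ × ℝ, PathOK k γ →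
      ∀ (m : ℕ) (F : Fin m → Quad (Set.univ : Set ℂ)), 0 < m →
        ∀ δ : ℝ, 0 < δ → δ ≤ 1 / 2 → ∀ vlo vhi : ℝ, 0 < vlo → vlo < vhi → vhi < 1 →
          ∃ Λ η₁ : ℝ, 0 < η₁ ∧ ∀ η ∈ Set.Ioo 0 η₁,
            ∀ ρ₀ ∈ Set.Icc (0 : ℝ) (1 - δ), ∀ c₀ ∈ Set.Icc (0 : ℝ) 1,
            ∀ ρ₁ ∈ Set.Icc (0 : ℝ) (1 - δ), ∀ c₁ ∈ Set.Icc (0 : ℝ) 1,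
              P k m F η ρ₀ c₀ ∈ Set.Icc vlo vhi → P k m F η ρ₁ c₁ = P k m F η ρ₀ c₀ →
                Dc k m F η (ρ₁, c₁) ≤ Λ * Dc k m F η (ρ₀, c₀) := by
  intro hIB k hk γ hγ m F hm δ hδ hδ' vlo vhi hvlo hvv hvhi
  -- ∫BET, boundary values, positivity of `Dc` on the band
  obtain ⟨Θ, ηB, -, hηB, hB⟩ := hIB k hk m F hm δ hδ hδ' vlo vhi hvlo hvv hvhi
  obtain ⟨ηV, hηV, hBV⟩ := stub_boundaryValues k hk γ hγ m F hm δ hδ hδ' vlo vhi hvlo hvv hvhi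
  obtain ⟨ηL, hηL, hLC⟩ :=
    levelCurves_unconditional k hk γ hγ m F hm δ hδ hδ' vlo vhi hvlo hvv hvhi
  refine ⟨Real.exp Θ, min ηB (min ηV ηL), lt_min hηB (lt_min hηV hηL), ?_⟩
  intro η hη ρ₀ hρ₀ c₀ hc₀ ρ₁ hρ₁ c₁ hc₁ hband hlev
  have hηB' : η ∈ Set.Ioo 0 ηB := ⟨hη.1, lt_of_lt_of_le hη.2 (min_le_left _ _)⟩
  have hηV' : η ∈ Set.Ioo 0 ηV :=
    ⟨hη.1, lt_of_lt_of_le hη.2 ((min_le_right _ _).trans (min_le_left _ _))⟩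
  have hηL' : η ∈ Set.Ioo 0 ηL :=
    ⟨hη.1, lt_of_lt_of_le hη.2 ((min_le_right _ _).trans (min_le_right _ _))⟩
  have hη0 : η ≠ 0 := hη.1.ne'
  obtain ⟨-, -, -, -, -, hPOS, -⟩ := hLC η hηL'
  have hBVη := hBV η hηV'
  set v := P k m F η ρ₀ c₀ with hv
  -- the polynomial `Φ` and its partials on the square
  obtain ⟨Φ, hΦ, hPΦ⟩ := exists_contDiff_two_eq_P k m F hη0
  have hΦd : Differentiable ℝ Φ := hΦ.differentiable (by norm_num)
  have hDρ : ∀ ρ ∈ Set.Icc (0 : ℝ) 1, ∀ c ∈ Set.Icc (0 : ℝ) 1,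
      Dρ k m F η (ρ, c) = fderiv ℝ Φ (ρ, c) (1, 0) := fun ρ hρ c hc =>
    derivWithin_eq_fderiv_fst (hΦd (ρ, c)) hρ (fun ρ' hρ' => hPΦ ρ' hρ' c hc)
  have hDc : ∀ ρ ∈ Set.Icc (0 : ℝ) 1, ∀ c ∈ Set.Icc (0 : ℝ) 1,
      Dc k m F η (ρ, c) = fderiv ℝ Φ (ρ, c) (0, 1) := fun ρ hρ c hc =>
    derivWithin_eq_fderiv_snd (hΦd (ρ, c)) hc (fun c' hc' => hPΦ ρ hρ c' hc')
  have hI : ∀ ρ ∈ Set.Icc (0 : ℝ) (1 - δ), ρ ∈ Set.Icc (0 : ℝ) 1 :=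
    fun ρ hρ => ⟨hρ.1, by linarith [hρ.2]⟩
  have h0 : (0 : ℝ) ∈ Set.Icc (0 : ℝ) 1 := ⟨le_rfl, zero_le_one⟩
  have h1 : (1 : ℝ) ∈ Set.Icc (0 : ℝ) 1 := ⟨zero_le_one, le_rfl⟩
  -- the level-`v` leaf over `[0, 1-δ]` (implicit function theorem)
  have hmonoΦ : ∀ ρ ∈ Set.Icc (0 : ℝ) (1 - δ), MonotoneOn (fun c => Φ (ρ, c)) (Set.Icc 0 1) := by
    intro ρ hρ c hc c' hc' hcc'
    show Φ (ρ, c) ≤ Φ (ρ, c')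
    rw [← hPΦ ρ (hI ρ hρ) c hc, ← hPΦ ρ (hI ρ hρ) c' hc']
    exact P_mono_c k m F hη0 ρ hcc'
  have hbv : ∀ ρ ∈ Set.Icc (0 : ℝ) (1 - δ), Φ (ρ, 0) < v ∧ v < Φ (ρ, 1) := by
    intro ρ hρ
    rw [← hPΦ ρ (hI ρ hρ) 0 h0, ← hPΦ ρ (hI ρ hρ) 1 h1]
    exact ⟨lt_of_lt_of_le (hBVη ρ hρ).1 hband.1, lt_of_le_of_lt hband.2 (hBVη ρ hρ).2⟩
  have hposΦ : ∀ ρ ∈ Set.Icc (0 : ℝ) (1 - δ), ∀ c ∈ Set.Icc (0 : ℝ) 1, Φ (ρ, c) = v →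
      0 < fderiv ℝ Φ (ρ, c) (0, 1) := by
    intro ρ hρ c hc hcv
    rw [← hDc ρ (hI ρ hρ) c hc]
    refine hPOS ρ hρ c hc ?_
    rw [hPΦ ρ (hI ρ hρ) c hc, hcv]
    exact hband
  obtain ⟨ℓ, hℓ, hℓ'⟩ :=
    stub_levelCurve_IFT Φ (hΦ.of_le (by norm_num)) 0 (1 - δ) v hbv hmonoΦ hposΦ
  have hℓ01 : ∀ ρ ∈ Set.Icc (0 : ℝ) (1 - δ), ℓ ρ ∈ Set.Icc (0 : ℝ) 1 := fun ρ hρ =>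
    ⟨(hℓ ρ hρ).1.1.le, (hℓ ρ hρ).1.2.le⟩
  have hc₀ℓ : c₀ = ℓ ρ₀ := (hℓ ρ₀ hρ₀).2.2 c₀ hc₀ (by rw [← hPΦ ρ₀ (hI ρ₀ hρ₀) c₀ hc₀])
  have hc₁ℓ : c₁ = ℓ ρ₁ :=
    (hℓ ρ₁ hρ₁).2.2 c₁ hc₁ (by rw [← hPΦ ρ₁ (hI ρ₁ hρ₁) c₁ hc₁]; exact hlev)
  have hposℓ : ∀ ρ ∈ Set.Icc (0 : ℝ) (1 - δ), 0 < fderiv ℝ Φ (ρ, ℓ ρ) (0, 1) := fun ρ hρ =>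
    hposΦ ρ hρ (ℓ ρ) (hℓ01 ρ hρ) (hℓ ρ hρ).2.1
  -- the leaf in `P`-terms: level selection and ODE, as consumed by ∫BET
  have hPℓ : ∀ ρ ∈ Set.Icc (0 : ℝ) (1 - δ), ℓ ρ ∈ Set.Icc (0 : ℝ) 1 ∧ P k m F η ρ (ℓ ρ) = v :=
    fun ρ hρ => ⟨hℓ01 ρ hρ, by rw [hPΦ ρ (hI ρ hρ) _ (hℓ01 ρ hρ)]; exact (hℓ ρ hρ).2.1⟩
  have hODE : ∀ ρ ∈ Set.Icc (0 : ℝ) (1 - δ), HasDerivWithinAt ℓ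
      (-(Dρ k m F η (ρ, ℓ ρ) / Dc k m F η (ρ, ℓ ρ))) (Set.Icc 0 (1 - δ)) ρ := by
    intro ρ hρ
    refine (hℓ' ρ hρ).congr_deriv ?_
    rw [hDρ ρ (hI ρ hρ) _ (hℓ01 ρ hρ), hDc ρ (hI ρ hρ) _ (hℓ01 ρ hρ)]
  -- ∫BET along this leaf between `ρ₀` and `ρ₁`
  have hbet := hB η hηB' v hband ℓ hPℓ hODE ρ₀ hρ₀ ρ₁ hρ₁
  -- the line's integrand is `∂_c(Φ_ρ/Φ_c)` along the leaf
  have hint_eq : ∀ ρ ∈ Set.Icc (0 : ℝ) (1 - δ),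
      derivWithin (fun c => Dρ k m F η (ρ, c) / Dc k m F η (ρ, c)) (Set.Icc 0 1) (ℓ ρ) =
        deriv (fun y => fderiv ℝ Φ (ρ, y) (1, 0) / fderiv ℝ Φ (ρ, y) (0, 1)) (ℓ ρ) := by
    intro ρ hρ
    have heq : Set.EqOn (fun c => Dρ k m F η (ρ, c) / Dc k m F η (ρ, c))
        (fun y => fderiv ℝ Φ (ρ, y) (1, 0) / fderiv ℝ Φ (ρ, y) (0, 1)) (Set.Icc 0 1) := by
      intro c hc
      simp only [hDρ ρ (hI ρ hρ) c hc, hDc ρ (hI ρ hρ) c hc]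
    rw [derivWithin_congr heq (heq (hℓ01 ρ hρ)),
      derivWithin_of_mem_nhds (Icc_mem_nhds (hℓ ρ hρ).1.1 (hℓ ρ hρ).1.2)]
  have hcongr : ∫ ρ in ρ₀..ρ₁, derivWithin (fun c => Dρ k m F η (ρ, c) / Dc k m F η (ρ, c))
      (Set.Icc 0 1) (ℓ ρ) =
      ∫ ρ in ρ₀..ρ₁, deriv (fun y => fderiv ℝ Φ (ρ, y) (1, 0) / fderiv ℝ Φ (ρ, y) (0, 1)) (ℓ ρ) :=
    intervalIntegral.integral_congr fun ρ hρ => hint_eq ρ (Set.uIcc_subset_Icc hρ₀ hρ₁ hρ)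
  -- (★) integrated along the leaf, and the log-variation bound
  have hFTC := integral_deriv_levelSlope_leaf hΦ hℓ' hposℓ hρ₀ hρ₁
  have hlog : |Real.log (fderiv ℝ Φ (ρ₁, ℓ ρ₁) (0, 1)) -
      Real.log (fderiv ℝ Φ (ρ₀, ℓ ρ₀) (0, 1))| ≤ Θ := by
    rw [← hFTC, ← hcongr]; exact hbet
  -- conclusion
  have ha : 0 < fderiv ℝ Φ (ρ₁, ℓ ρ₁) (0, 1) := hposℓ ρ₁ hρ₁
  have hb : 0 < fderiv ℝ Φ (ρ₀, ℓ ρ₀) (0, 1) := hposℓ ρ₀ hρ₀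
  rw [hDc ρ₁ (hI ρ₁ hρ₁) c₁ hc₁, hDc ρ₀ (hI ρ₀ hρ₀) c₀ hc₀, hc₀ℓ, hc₁ℓ]
  have h := (abs_le.1 hlog).2
  calc fderiv ℝ Φ (ρ₁, ℓ ρ₁) (0, 1)
      = Real.exp (Real.log (fderiv ℝ Φ (ρ₁, ℓ ρ₁) (0, 1))) := (Real.exp_log ha).symm
    _ ≤ Real.exp (Θ + Real.log (fderiv ℝ Φ (ρ₀, ℓ ρ₀) (0, 1))) := Real.exp_le_exp.2 (by linarith)
    _ = Real.exp Θ * fderiv ℝ Φ (ρ₀, ℓ ρ₀) (0, 1) := by rw [Real.exp_add, Real.exp_log hb]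

end Summit.CriticalPhenomena.CardyFormulaZ2.Theorems.CardySelfRefinement

end
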